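import Summits.HodgeConjecture.HodgeConjecture.Theorems.LinearSystemTorelliLocalTubeSpanTypedBasis
import Summits.HodgeConjecture.HodgeConjecture.Theorems.LinearSystemTorelliLocalTubeSpanTypedInstances
import Summits.HodgeConjecture.HodgeConjecture.Theorems.LinearSystemTorelliLocalTubeSpanIndependentCycles

/-!
# Route LinearSystemTorelli — crux `LocalTubeSpan` (stmt-HodgeConjecture-2490): the isolated singular point along a neighbourhood basis (capstone, unconditional)

Helper file (`--supports stmt-HodgeConjecture-2490`, line `Sketch` of the crux chain, cycle 7
wave 3, continuation lead c6; stub `capstoneIsolated`, composition).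

Companion of `…Capstone` (NC-nodal member along a basis, unconditionally) and `…CapstoneOrbit`
(one complete orbit along a basis, granting Schnell's Lemma 11): the typed crux in colimit form at a
point `t₀` which is an ISOLATED SINGULAR POINT of the local configuration, stated along a
neighbourhood BASIS (the sound shape of cycle 6, `…TypedBasis`), UNCONDITIONALLY — one local
subgroup per basic set presented by a distinguished basis (Brieskorn–Gabrielov: the meridians along
a distinguished basis of the Milnor lattice act as Picard–Lefschetz transvections along linearly
independent vanishing cycles with connected diagram) ⇒ the typed crux in colimit form at `t₀`:

* `localTubeSpan_cfree_at_of_distinguishedBasisBasis` — for the direct-image local system of a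
  smooth projective family, if along a basis of `𝓝 t₀` every basic set has path-connected
  punctured preimage and ONE local subgroup generated by finitely many elements acting on
  `Hᵏ(X_s(ℂ); ℚ)` through the rational monodromy as transvections `x ↦ x - B(x, δᵢ) δᵢ` of an
  alternating form `B` along LINEARLY INDEPENDENT cycles `δᵢ` with connected diagram
  (`∀ i, ∃ j, B (δ i) (δ j) ≠ 0`), then every class undetected near `t₀` lies in
  `localKernel ι (D.V k) s t₀`;
* `localTubeSpan_injective_evalCoinv_res_rat_of_independentCycles`,
  `localTubeSpan_cfree_at_of_independentCyclesBasis` — the variant WITHOUT the connected-diagram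
  hypothesis when the alternating form is NONDEGENERATE: one local subgroup per basic set generated
  by a finite set of elements acting as transvections along cycles which are linearly independent
  on the generating set (`localTubeSpan_injective_evalCoinv_of_independentCycles`: the isolated
  vertices of the Dynkin graph are split off by `B`-duality) ⇒ the typed crux in colimit form at
  `t₀`.

No named facts; no `sorry`.
-/

-- `Summit.HodgeConjecture.HodgeConjecture.Theorems` is the mandated namespace (single-conjunct summit:
-- Sub = Summit), which `linter.dupNamespace` flags on every declaration; the lakefile turns the
-- linter off tree-wide (weak option), restated here so stand-alone elaboration is warning-free too.
set_option linter.dupNamespace false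

noncomputable section

open CategoryTheory groupCohomology
open _root_.Topology Filter
open Literature.AlgebraicGeometry Literature.AlgebraicGeometry.HodgeTheory
open Literature.AlgebraicTopology.SingularHomology

namespace Summit.HodgeConjecture.HodgeConjecture.Theorems

universe v

variable {𝒳 Sb : Motives.SchemeOver ℂ} {π : 𝒳 ⟶ Sb} {n : ℕ} {T : Type v} [TopologicalSpace T]

/-- **The isolated singular point along a neighbourhood basis (full carrier), unconditionally.**
For the direct-image local system `Rᵏ π_* ℂ|_U` of a smooth projective family, a base point `s`, a
continuous `ι : U → T` and a basis `(bs i)_{p i}` of `𝓝 t₀` such that every basic set has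
path-connected `ι⁻¹ (bs i)` and ONE local subgroup `S = localSubgroup ι s (bs i) hs' γ` presented by
a distinguished basis — finitely many generators `t a ∈ S` (`⟨t a⟩ = S`) acting on `Hᵏ(X_s(ℂ); ℚ)`
through the rational monodromy as the Picard–Lefschetz transvections `x ↦ x - B(x, δ a) δ a` of an
alternating form `B` along LINEARLY INDEPENDENT cycles `δ a`, no one of them `B`-orthogonal to all
(connected diagram; the local vanishing configuration at an isolated singular point of a member, by
Brieskorn–Gabrielov): every class undetected on the local subgroups of some neighbourhood of `t₀`
lies in `localKernel ι (D.V k) s t₀` — the colimit form of the crux at `t₀`, with NO named fact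
(`localTubeSpan_injective_evalCoinv_res_rat_of_distinguishedBasis` per basic set +
`localTubeSpan_mem_localKernel_of_rat_hasBasis_one`).
[cite: Schnell2010, §7 Prop. 12 (local form)] -/
theorem localTubeSpan_cfree_at_of_distinguishedBasisBasis
    (ι : C(smoothFiberLocus π n, T)) (D : DirectImageLocalSystem π n) (k : ℕ)
    (s : smoothFiberLocus π n) {ι' : Sort*} {p : ι' → Prop} {bs : ι' → Set T} {t₀ : T}
    (hbs : (𝓝 t₀).HasBasis p bs)
    (hdb : ∀ i, p i → IsPathConnected (ι ⁻¹' bs i) ∧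
      ∃ (s' : smoothFiberLocus π n) (hs' : ι s' ∈ bs i) (γ : Path s' s)
        (B : LinearMap.BilinForm ℚ (Motives.bettiCohomology (Motives.fiberOver π s.1) k))
        (r : ℕ) (t : Fin r → localSubgroup ι s (bs i) hs' γ)
        (δ : Fin r → Motives.bettiCohomology (Motives.fiberOver π s.1) k),
        B.IsAlt ∧ Subgroup.closure (Set.range t) = ⊤ ∧ LinearIndependent ℚ δ ∧
        (∀ (a : Fin r) (x : Motives.bettiCohomology (Motives.fiberOver π s.1) k),
          D.ratMonodromy k s (t a : FundamentalGroup (smoothFiberLocus π n) s) x =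
            x - B x (δ a) • δ a) ∧
        (∀ a : Fin r, ∃ a' : Fin r, B (δ a) (δ a') ≠ 0))
    (ξ : groupCohomology.H1 (monodromyRepObj (D.V k) s))
    (hξ : ∃ N ∈ 𝓝 t₀, ∀ (s' : smoothFiberLocus π n) (hs' : ι s' ∈ N) (γ : Path s' s),
      evalCoinvOn (monodromyRepObj (D.V k) s) (localSubgroup ι s N hs' γ) ξ = 0) :
    ξ ∈ localKernel ι (D.V k) s t₀ := by
  refine localTubeSpan_mem_localKernel_of_rat_hasBasis_one ι D k s hbs (fun i hi => ?_) ξ hξ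
  obtain ⟨hpc, s', hs', γ, B, r, t, δ, hB, ht, hli, hPL, hconn⟩ := hdb i hi
  exact ⟨hpc, s', hs', γ, localTubeSpan_injective_evalCoinv_res_rat_of_distinguishedBasis D k s _
    B hB t ht δ hli hPL hconn⟩

/-! ### Variant: linearly independent cycles of a nondegenerate form (no connectedness) -/

/-- **`ℚ`-cyclic detection at a local subgroup presented by linearly independent cycles of a
nondegenerate form.**  If `S ≤ π₁(U, s)` is generated by a finite set `gen` of elements acting on
`Hᵏ(X_s(ℂ); ℚ)` through the rational monodromy as the transvections `x ↦ x - B(x, e t) e t` of a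
NONDEGENERATE alternating form `B` along cycles `e t`, `t ∈ gen`, which are linearly independent on
`gen`, then Schnell's third map of the rational monodromy restricted to `S` is injective — no
connectedness of the Dynkin graph is needed
(`localTubeSpan_injective_evalCoinv_of_independentCycles`; no named fact).
[cite: Schnell2010, §7 Prop. 12] -/
theorem localTubeSpan_injective_evalCoinv_res_rat_of_independentCycles
    (D : DirectImageLocalSystem π n) (k : ℕ) (s : smoothFiberLocus π n)
    (S : Subgroup (FundamentalGroup (smoothFiberLocus π n) s))
    (B : LinearMap.BilinForm ℚ (Motives.bettiCohomology (Motives.fiberOver π s.1) k))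
    (hBnd : B.Nondegenerate) (hB : B.IsAlt) (gen : Set S) (hfin : gen.Finite)
    (hgen : Subgroup.closure gen = ⊤)
    (e : S → Motives.bettiCohomology (Motives.fiberOver π s.1) k)
    (hPL : ∀ t ∈ gen, ∀ x : Motives.bettiCohomology (Motives.fiberOver π s.1) k,
      D.ratMonodromy k s (t : FundamentalGroup (smoothFiberLocus π n) s) x = x - B x (e t) • e t)
    (hli : LinearIndependent ℚ (fun t : gen => e t)) :
    Function.Injective (evalCoinv (Rep.res S.subtype (Rep.of (D.ratMonodromy k s)))) := by
  haveI : FiniteDimensional ℚ (Rep.res S.subtype (Rep.of (D.ratMonodromy k s))).V :=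
    (localTubeSpan_ratTensorEquiv D k s _ (D.ofRatClass_ratMonodromy k s)).1
  exact localTubeSpan_injective_evalCoinv_of_independentCycles
    (Rep.res S.subtype (Rep.of (D.ratMonodromy k s))) B hBnd hB gen hfin hgen e
    (fun t ht x => hPL t ht x) hli

/-- **Linearly independent cycles of a nondegenerate form along a neighbourhood basis (full
carrier), unconditionally.**  For the direct-image local system `Rᵏ π_* ℂ|_U` of a smooth projective
family, a base point `s`, a continuous `ι : U → T` and a basis `(bs i)_{p i}` of `𝓝 t₀` such that
every basic set has path-connected `ι⁻¹ (bs i)` and ONE local subgroup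
`S = localSubgroup ι s (bs i) hs' γ` generated by a finite set `gen` acting on `Hᵏ(X_s(ℂ); ℚ)`
through the rational monodromy as the Picard–Lefschetz transvections `x ↦ x - B(x, e t) e t` of a
NONDEGENERATE alternating form `B` along cycles `e t` linearly independent on `gen` (isolated
singular points of a member whose vanishing cycles stay independent in `Hᵏ(X_s(ℂ); ℚ)`, with no
hypothesis on the Dynkin graph): every class undetected on the local subgroups of some neighbourhood
of `t₀` lies in `localKernel ι (D.V k) s t₀` — the colimit form of the crux at `t₀`, with NO named
fact (`localTubeSpan_injective_evalCoinv_res_rat_of_independentCycles` per basic set +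
`localTubeSpan_mem_localKernel_of_rat_hasBasis_one`).
[cite: Schnell2010, §7 Prop. 12 (local form)] -/
theorem localTubeSpan_cfree_at_of_independentCyclesBasis
    (ι : C(smoothFiberLocus π n, T)) (D : DirectImageLocalSystem π n) (k : ℕ)
    (s : smoothFiberLocus π n) {ι' : Sort*} {p : ι' → Prop} {bs : ι' → Set T} {t₀ : T}
    (hbs : (𝓝 t₀).HasBasis p bs)
    (hic : ∀ i, p i → IsPathConnected (ι ⁻¹' bs i) ∧
      ∃ (s' : smoothFiberLocus π n) (hs' : ι s' ∈ bs i) (γ : Path s' s)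
        (B : LinearMap.BilinForm ℚ (Motives.bettiCohomology (Motives.fiberOver π s.1) k))
        (gen : Set (localSubgroup ι s (bs i) hs' γ))
        (e : localSubgroup ι s (bs i) hs' γ → Motives.bettiCohomology (Motives.fiberOver π s.1) k),
        B.Nondegenerate ∧ B.IsAlt ∧ gen.Finite ∧ Subgroup.closure gen = ⊤ ∧
        (∀ t ∈ gen, ∀ x : Motives.bettiCohomology (Motives.fiberOver π s.1) k,
          D.ratMonodromy k s (t : FundamentalGroup (smoothFiberLocus π n) s) x =
            x - B x (e t) • e t) ∧
        LinearIndependent ℚ (fun t : gen => e t))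
    (ξ : groupCohomology.H1 (monodromyRepObj (D.V k) s))
    (hξ : ∃ N ∈ 𝓝 t₀, ∀ (s' : smoothFiberLocus π n) (hs' : ι s' ∈ N) (γ : Path s' s),
      evalCoinvOn (monodromyRepObj (D.V k) s) (localSubgroup ι s N hs' γ) ξ = 0) :
    ξ ∈ localKernel ι (D.V k) s t₀ := by
  refine localTubeSpan_mem_localKernel_of_rat_hasBasis_one ι D k s hbs (fun i hi => ?_) ξ hξ
  obtain ⟨hpc, s', hs', γ, B, gen, e, hBnd, hB, hfin, hgen, hPL, hli⟩ := hic i hi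
  exact ⟨hpc, s', hs', γ, localTubeSpan_injective_evalCoinv_res_rat_of_independentCycles D k s _
    B hBnd hB gen hfin hgen e hPL hli⟩

end Summit.HodgeConjecture.HodgeConjecture.Theorems

end
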